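import Summits.QuantumAdvantage.QuantumAdvantage.Theorems.LinnikCubicClassGroupsDegreeOnePrimesEscapeClassPNTTZFormPi
import HarnessLib

/-!
# Thorner–Zaman (2019) Thm 1.4 for the ideal classes of EVERY quadratic field

Topic `Summits/QuantumAdvantage/QuantumAdvantage/Theorems`, cell B2b-1 (linnik-cubic), PART A (gen 32);
helper toward the crux `DegreeOnePrimesEscape` (stmt-QuantumAdvantage-11543) of route
`LinnikCubicClassGroups`.  HONEST FRAMING: the value of this file is a THEOREM (kernel-checked, GRH-free,
Siegel-free) — NOT summit progress (the route still rests on the hypothesis-type target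
`PureCubicClassNumberHard`).

`classPNT_TZ_quadratic`: the statement of the tree's named fact
`ThornerZaman2019_classPNT_imaginaryQuadratic` (`UniformClassGroupPNT.lean`; `Q = condQ K = 4|d_K|`,
`E(x) = c₃ (e^{−c₂ log x/log Q} + e^{−(c₂ log x/2)^{1/2}})`, window `1 − 1/(8 log Q)`) for EVERY quadratic
field — real quadratic fields included (the named fact, proved in `…ClassPNTTZForm.lean`, restricts to
`IsTotallyComplex K`).  It is `classPNT_TZ_dichotomy 2` (`…ClassPNTTZFormPi.lean`) in the quadratic vocabulary
(`condQn_eq_condQ`, `errorTermN_two`).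

Reference: J. Thorner, A. Zaman, Algebra Number Theory 13 (2019), Thm. 1.4 [ThornerZaman2019].
-/

noncomputable section

open scoped NumberField
open Real MeasureTheory Set NumberField

namespace Summit.QuantumAdvantage.QuantumAdvantage.Theorems.DegreeOnePrimesEscape

open Literature.NumberTheory.LFunctions Literature.NumberTheory.LFunctions.NumberField

/-- **Thorner–Zaman (2019), Theorem 1.4, for the ideal classes of every quadratic field** (real or
imaginary): with absolute `c₁, c₂, c₃ > 0`, `Q = 4|d_K|`, `h = h_K`: EITHER no real class group character
has a real zero of `L(s, χ)` in `(1 − 1/(8 log Q), 1)` and `|π_C(x) − Li(x)/h| ≤ c₃ E(x) Li(x)/h` for all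
classes `C`, `x ≥ Q^{c₁}`, OR there are a real `χ₁` and a real zero `β₁` in that window with
`|π_C(x) − (Li(x) − χ₁(C) Li(x^{β₁}))/h| ≤ c₃ E(x) (Li(x) − χ₁(C) Li(x^{β₁}))/h`,
`E(x) = errorTerm c₂ Q x`. [cite: ThornerZaman2019, Theorem 1.4] -/
theorem classPNT_TZ_quadratic :
    ∃ c₁ c₂ c₃ : ℝ, 0 < c₁ ∧ 0 < c₂ ∧ 0 < c₃ ∧
    ∀ (K : Type) [Field K] [NumberField K], Module.finrank ℚ K = 2 →
      (((∀ χ : ClassGroup (𝓞 K) →* ℂˣ, χ * χ = 1 →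
            ∀ β : ℝ, 1 - 1 / (8 * Real.log (ThornerZaman.condQ K)) < β → β < 1 →
              classGroupLFunction K χ β ≠ 0) ∧
          ∀ (C : ClassGroup (𝓞 K)) (x : ℝ), ThornerZaman.condQ K ^ c₁ ≤ x →
            |(primeIdealClassCount K C x : ℝ) - offsetLogIntegral x / NumberField.classNumber K| ≤
              c₃ * ThornerZaman.errorTerm c₂ (ThornerZaman.condQ K) x *
                (offsetLogIntegral x / NumberField.classNumber K)) ∨
        ∃ (χ₁ : ClassGroup (𝓞 K) →* ℂˣ) (β₁ : ℝ), χ₁ * χ₁ = 1 ∧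
          1 - 1 / (8 * Real.log (ThornerZaman.condQ K)) < β₁ ∧ β₁ < 1 ∧
          classGroupLFunction K χ₁ β₁ = 0 ∧
          ∀ (C : ClassGroup (𝓞 K)) (x : ℝ), ThornerZaman.condQ K ^ c₁ ≤ x →
            |(primeIdealClassCount K C x : ℝ) -
                (offsetLogIntegral x - ((χ₁ C : ℂ)).re * offsetLogIntegral (x ^ β₁)) /
                  NumberField.classNumber K| ≤
              c₃ * ThornerZaman.errorTerm c₂ (ThornerZaman.condQ K) x *
                ((offsetLogIntegral x - ((χ₁ C : ℂ)).re * offsetLogIntegral (x ^ β₁)) /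
                  NumberField.classNumber K)) := by
  obtain ⟨c₁, c₂, c₃, hc₁, hc₂, hc₃, H⟩ := classPNT_TZ_dichotomy 2 one_lt_two
  refine ⟨c₁, c₂, c₃, hc₁, hc₂, hc₃, fun K _ _ h2 ↦ ?_⟩
  have hK := H K h2
  rw [ThornerZaman.condQn_eq_condQ K h2] at hK
  simp only [ThornerZaman.errorTermN_two] at hK
  exact hK

end Summit.QuantumAdvantage.QuantumAdvantage.Theorems.DegreeOnePrimesEscape

end
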